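import Mathlib
import Summits.Ventures.Crystal3D.Theorems.StickyWulffConstantTextureLiminfTentTables
import Summits.Ventures.Crystal3D.StickySpheres.FccChunks
import Literature.MathematicalPhysics.StatisticalMechanics.FccSurfaceTension
import Literature.Barriers.AtomisticToContinuum.TetrahedralFrustrationRogers
import HarnessLib

/-!
# The tent certificate for fcc grains — (T1), part B: the LOCAL form and the full-cell volume count

(File 2 of 3; see `StickyWulffConstantTextureLiminfTentTables.lean` for the overview.)  This part:
* `brokenBonds`, `covered`, `coveredBonds`, `tentCostOn24` and **`tentCostOn24_le`**: for EVERY family of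
  cells the tent cost is at most `12 ·` the number of broken bonds lying in a cell of the family
  (ROUTE.md §71.8 local currency; `card_brokenBonds_sdiff` gives the complementary count);
* `fullVolT_ge`: `6·#A − 10·B∂ ≤ #full T⁺ + #full T⁻ + 4·#full O` (full cells carry almost all the volume).
WHAT THIS IS NOT: the FREE_f statement, (T2); F-C1 not moved.
-/

noncomputable section

namespace Summit.Ventures.Crystal3D.TentCertificate

open Finset Summit.Ventures.Crystal3D MeasureTheory
open Literature.Geometry.DiscreteGeometry (intVec intVec_apply)
open Literature.MathematicalPhysics.StatisticalMechanics (phiFcc phiFcc_eq_sum_max phiFcc_smul phiFcc_neg)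
open Literature.Barriers.AtomisticToContinuum (rogersSimplex edgeMap paramSimplex
  volume_rogersSimplex_eq_det det_edgeMap volume_paramSimplex)
open scoped RealInnerProductSpace

/-! ## Local form of (T1): any family of cells (ROUTE §71.8)

A *broken bond* of `A` is encoded as a pair `(x, δ)` with `x ∈ A`, `δ ∈ fccOffsets`, `x + δ ∉ A`
(occupied end first — this lists every occupied–vacant nearest-neighbour pair exactly once, and
`#brokenBonds A = bdPairs A = 2·D(A)`).  It *lies in* the cell with vertex offsets `v` placed at `p`
when `x = p + v i`, `x + δ = p + v j` for an (adjacent) slot pair `(i, j)`.  For ANY family of cells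
— up-tetrahedra placed at the points of `U`, down-tetrahedra at `D`, octahedra at `O` — the tent
cost of the family is at most `½ · #{broken bonds lying in some cell of the family}`
(`tentCostOn24_le`, in units of `1/24`): a broken bond is a vertex pair of at most one up-, one
down-tetrahedron and two octahedra, which charge it `2, 2, 4, 4`. -/

/-- broken bonds `(x, δ)`: `x ∈ A`, `δ` a neighbour offset, `x + δ ∉ A`. -/
def brokenBonds (A : Finset Site) : Finset (Site × Site) :=
  (A ×ˢ fccOffsets).filter fun q => q.1 + q.2 ∉ A

/-- `#brokenBonds A = bdPairs A`. -/
theorem card_brokenBonds (A : Finset Site) : (brokenBonds A).card = bdPairs A := by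
  classical
  unfold brokenBonds bdPairs g
  rw [card_filter, sum_product_right]
  refine sum_congr rfl fun δ _ => ?_
  rw [card_filter]

section localForm
variable {n : ℕ} (v : Fin n → Site) (S : Finset (Fin n × Fin n))

/-- occupied–vacant slot pairs of the cell `(v, S)` placed at `p`. -/
def ovSlots (A : Finset Site) (p : Site) : Finset (Fin n × Fin n) :=
  S.filter fun s => p + v s.1 ∈ A ∧ p + v s.2 ∉ A

/-- the broken bonds lying in some cell `(v, S)` placed at a point of `P`. -/
def covered (A P : Finset Site) : Finset (Site × Site) :=
  ((P ×ˢ S).filter fun a => a.1 + v a.2.1 ∈ A ∧ a.1 + v a.2.2 ∉ A).image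
    fun a => (a.1 + v a.2.1, v a.2.2 - v a.2.1)

/-- Membership in `covered`: the broken bond is a slot pair of a cell of the family. -/
theorem mem_covered {A P : Finset Site} {q : Site × Site} :
    q ∈ covered v S A P ↔ ∃ p ∈ P, ∃ s ∈ S,
      p + v s.1 ∈ A ∧ p + v s.2 ∉ A ∧ q = (p + v s.1, v s.2 - v s.1) := by
  unfold covered
  rw [mem_image]
  constructor
  · rintro ⟨⟨p, s⟩, ha, rfl⟩
    rw [mem_filter, mem_product] at ha
    exact ⟨p, ha.1.1, s, ha.1.2, ha.2.1, ha.2.2, rfl⟩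
  · rintro ⟨p, hp, s, hs, h1, h2, rfl⟩
    exact ⟨(p, s), by rw [mem_filter, mem_product]; exact ⟨⟨hp, hs⟩, h1, h2⟩, rfl⟩

/-- Covered bonds are broken bonds. -/
theorem covered_subset (himg : ∀ s ∈ S, v s.2 - v s.1 ∈ fccOffsets) (A P : Finset Site) :
    covered v S A P ⊆ brokenBonds A := by
  intro q hq
  obtain ⟨p, _, s, hs, h1, h2, rfl⟩ := (mem_covered v S).mp hq
  simp only [brokenBonds, mem_filter, mem_product]
  refine ⟨⟨h1, himg s hs⟩, ?_⟩
  have : p + v s.1 + (v s.2 - v s.1) = p + v s.2 := by abel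
  rw [this]; exact h2

/-- the double count: `Σ_{p ∈ P} #ovSlots ≤ m · #covered`, `m` = the largest multiplicity of a
neighbour offset among the slot differences of the cell (`1` for tetrahedra, `2` for octahedra). -/
theorem sum_card_ovSlots_le (m : ℕ)
    (hfib : ∀ δ ∈ fccOffsets, (S.filter fun s => v s.2 - v s.1 = δ).card ≤ m)
    (himg : ∀ s ∈ S, v s.2 - v s.1 ∈ fccOffsets) (A P : Finset Site) :
    ∑ p ∈ P, (ovSlots v S A p).card ≤ m * (covered v S A P).card := by
  classical
  have hsum : ∑ p ∈ P, (ovSlots v S A p).card =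
      ((P ×ˢ S).filter fun a => a.1 + v a.2.1 ∈ A ∧ a.1 + v a.2.2 ∉ A).card := by
    rw [card_filter, sum_product]
    refine sum_congr rfl fun p _ => ?_
    rw [ovSlots, card_filter]
  have hmaps : ∀ a ∈ ((P ×ˢ S).filter fun a => a.1 + v a.2.1 ∈ A ∧ a.1 + v a.2.2 ∉ A),
      (fun a => (a.1 + v a.2.1, v a.2.2 - v a.2.1)) a ∈ covered v S A P :=
    fun a ha => mem_image_of_mem _ ha
  rw [hsum, card_eq_sum_card_fiberwise hmaps]
  calc ∑ b ∈ covered v S A P, (((P ×ˢ S).filter fun a => a.1 + v a.2.1 ∈ A ∧ a.1 + v a.2.2 ∉ A).filter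
          fun a => (a.1 + v a.2.1, v a.2.2 - v a.2.1) = b).card
      ≤ ∑ b ∈ covered v S A P, m := sum_le_sum fun b hb => ?_
    _ = m * (covered v S A P).card := by rw [sum_const, smul_eq_mul, mul_comm]
  have hδ : b.2 ∈ fccOffsets := by
    have hb' := covered_subset v S himg A P hb
    simp only [brokenBonds, mem_filter, mem_product] at hb'
    exact hb'.1.2
  refine le_trans ?_ (hfib b.2 hδ)
  refine card_le_card_of_injOn (fun a => a.2) (fun a ha => ?_) (fun a ha a' ha' h => ?_)
  · rw [mem_coe, mem_filter] at ha
    rw [mem_coe, mem_filter]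
    obtain ⟨haT, hab⟩ := ha
    refine ⟨(mem_product.mp (mem_filter.mp haT).1).2, ?_⟩
    rw [← hab]
  · rw [mem_coe, mem_filter] at ha ha'
    obtain ⟨_, hab⟩ := ha
    obtain ⟨_, hab'⟩ := ha'
    have h2 : a.2 = a'.2 := h
    have h1 : a.1 + v a.2.1 = a'.1 + v a'.2.1 := by
      have e1 := congrArg Prod.fst hab
      have e2 := congrArg Prod.fst hab'
      simp only at e1 e2
      rw [e1, e2]
    rw [h2] at h1
    exact Prod.ext (add_right_cancel h1) h2

end localForm

/-- Up-tetrahedron slot differences are neighbour offsets. -/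
theorem tetUp_himg : ∀ s ∈ slotsTet, tetUpV s.2 - tetUpV s.1 ∈ fccOffsets := by decide
/-- Down-tetrahedron slot differences are neighbour offsets. -/
theorem tetDn_himg : ∀ s ∈ slotsTet, tetDnV s.2 - tetDnV s.1 ∈ fccOffsets := by decide
/-- Octahedron (non-antipodal) slot differences are neighbour offsets. -/
theorem oct_himg : ∀ s ∈ slotsOct, octV s.2 - octV s.1 ∈ fccOffsets := by decide

/-- `eTetUp A p` is the number of occupied–vacant slots of the up-tetrahedron at `p`. -/
theorem eTetUp_eq_card (A : Finset Site) (p : Site) :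
    eTetUp A p = ((ovSlots tetUpV slotsTet A p).card : ℤ) := by
  classical
  unfold eTetUp ovSlots slotsTet
  rw [filter_filter, card_filter, Nat.cast_sum, ← univ_product_univ, sum_product]
  refine sum_congr rfl fun i _ => sum_congr rfl fun j _ => ?_
  by_cases hij : i = j
  · subst hij; simp
  · simp [hij]

/-- `eTetDn A p` is the number of occupied–vacant slots of the down-tetrahedron at `p`. -/
theorem eTetDn_eq_card (A : Finset Site) (p : Site) :
    eTetDn A p = ((ovSlots tetDnV slotsTet A p).card : ℤ) := by
  classical
  unfold eTetDn ovSlots slotsTet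
  rw [filter_filter, card_filter, Nat.cast_sum, ← univ_product_univ, sum_product]
  refine sum_congr rfl fun i _ => sum_congr rfl fun j _ => ?_
  by_cases hij : i = j
  · subst hij; simp
  · simp [hij]

/-- `eOct A p` is the number of occupied–vacant non-antipodal slots of the octahedron at `p`. -/
theorem eOct_eq_card (A : Finset Site) (p : Site) :
    eOct A p = ((ovSlots octV slotsOct A p).card : ℤ) := by
  classical
  unfold eOct ovSlots slotsOct
  rw [filter_filter, card_filter, Nat.cast_sum, ← univ_product_univ, sum_product]
  refine sum_congr rfl fun i _ => sum_congr rfl fun j _ => ?_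
  by_cases hn : nonAnti i j = true
  · simp [hn]
  · simp [hn]

/-- the broken bonds lying in at least one cell of the family: up-tetrahedra `T⁺(p)`, `p ∈ U`,
down-tetrahedra `T⁻(p)`, `p ∈ D`, octahedra `O(p)`, `p ∈ O`. -/
def coveredBonds (A U D O : Finset Site) : Finset (Site × Site) :=
  covered tetUpV slotsTet A U ∪ covered tetDnV slotsTet A D ∪ covered octV slotsOct A O

/-- Bonds covered by a cell family are broken bonds. -/
theorem coveredBonds_subset (A U D O : Finset Site) : coveredBonds A U D O ⊆ brokenBonds A := by
  unfold coveredBonds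
  exact union_subset (union_subset (covered_subset _ _ tetUp_himg A U)
    (covered_subset _ _ tetDn_himg A D)) (covered_subset _ _ oct_himg A O)

/-- A cell family covers at most `bdPairs A` broken bonds. -/
theorem card_coveredBonds_le (A U D O : Finset Site) : (coveredBonds A U D O).card ≤ bdPairs A := by
  rw [← card_brokenBonds]; exact card_le_card (coveredBonds_subset A U D O)

/-- the tent cost of the family in units of `1/24`. -/
def tentCostOn24 (A U D O : Finset Site) : ℤ :=
  ∑ p ∈ U, 2 * eTetUp A p + ∑ p ∈ D, 2 * eTetDn A p + ∑ p ∈ O, octCost24 (patO A p)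

/-- The global tent cost is the local cost of the full family `idx A`. -/
theorem tentCost24_eq_tentCostOn24 (A : Finset Site) :
    tentCost24 A = tentCostOn24 A (idx A) (idx A) (idx A) := by
  unfold tentCost24 tentCostOn24
  rw [sum_add_distrib, sum_add_distrib]

/-- **(T1), local form.**  For every finite `A` and EVERY family of cells, the tent cost of the family
is at most `12 · #{broken bonds lying in a cell of the family}` in units of `1/24`, i.e. at most
`½ · #{…}` in units of `D`. -/
theorem tentCostOn24_le (A U D O : Finset Site) :
    tentCostOn24 A U D O ≤ 12 * ((coveredBonds A U D O).card : ℤ) := by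
  classical
  have cU : (covered tetUpV slotsTet A U).card ≤ (coveredBonds A U D O).card :=
    card_le_card (subset_union_left.trans subset_union_left)
  have cD : (covered tetDnV slotsTet A D).card ≤ (coveredBonds A U D O).card :=
    card_le_card (subset_union_right.trans subset_union_left)
  have cO : (covered octV slotsOct A O).card ≤ (coveredBonds A U D O).card :=
    card_le_card subset_union_right
  have hU : ∑ p ∈ U, eTetUp A p ≤ ((coveredBonds A U D O).card : ℤ) := by
    have h := sum_card_ovSlots_le tetUpV slotsTet 1 (fun δ hδ => (fiber_slotsTetUp δ hδ).le)
      tetUp_himg A U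
    simp_rw [eTetUp_eq_card]
    rw [← Nat.cast_sum]
    exact_mod_cast (h.trans (by rw [one_mul]; exact cU))
  have hD : ∑ p ∈ D, eTetDn A p ≤ ((coveredBonds A U D O).card : ℤ) := by
    have h := sum_card_ovSlots_le tetDnV slotsTet 1 (fun δ hδ => (fiber_slotsTetDn δ hδ).le)
      tetDn_himg A D
    simp_rw [eTetDn_eq_card]
    rw [← Nat.cast_sum]
    exact_mod_cast (h.trans (by rw [one_mul]; exact cD))
  have hO : ∑ p ∈ O, eOct A p ≤ 2 * ((coveredBonds A U D O).card : ℤ) := by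
    have h := sum_card_ovSlots_le octV slotsOct 2 (fun δ hδ => (fiber_slotsOct δ hδ).le)
      oct_himg A O
    simp_rw [eOct_eq_card]
    rw [← Nat.cast_sum]
    exact_mod_cast (h.trans (Nat.mul_le_mul_left 2 cO))
  have hO' : ∑ p ∈ O, octCost24 (patO A p) ≤ ∑ p ∈ O, 4 * eOct A p :=
    sum_le_sum fun p _ => by rw [← eOVb_patO]; exact oct_table _
  unfold tentCostOn24
  rw [← mul_sum, ← mul_sum]
  rw [← mul_sum] at hO'
  linarith

/-- complement count: the broken bonds in NO cell of the family number `bdPairs A − #coveredBonds`. -/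
theorem card_brokenBonds_sdiff (A U D O : Finset Site) :
    (brokenBonds A \ coveredBonds A U D O).card + (coveredBonds A U D O).card = bdPairs A := by
  rw [card_sdiff_add_card_eq_card (coveredBonds_subset A U D O), card_brokenBonds]

/-- `12 · bdPairs A = 144·#A − 12·orderedBonds A = 24·D(A)`. -/
theorem twelve_bdPairs (A : Finset Site) :
    12 * (bdPairs A : ℤ) = 144 * (A.card : ℤ) - 12 * (orderedBonds A : ℤ) := by
  have h : (bdPairs A : ℤ) + (orderedBonds A : ℤ) = 12 * (A.card : ℤ) := by
    exact_mod_cast bdPairs_add_orderedBonds A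
  linarith

/-! ## Full cells carry almost all the volume: `6·#A − 10·B∂ ≤ #full T⁺ + #full T⁻ + 4·#full O`

In units of `|T| = 1/(6√2)` (`|O| = 4|T|`, volume per site `2|T| + |O| = 6|T| = 1/√2`): a cell all
of whose vertices are occupied has `f_A ≡ 1` on it; every other cell with an occupied vertex has a
broken edge; a broken bond is an edge of one up-, one down-tetrahedron and two octahedra (weights
`1, 1, 4, 4`, total `10`).  Hence `|{f_A = 1}| ≥ |Full(A)| ≥ (6·#A − 10·B∂)·|T| = #A/√2 − (10/(3√2))·D(A)`
— the volume clause of the FREE certificate (`C₀ = 10/(3√2) ≈ 2.357`), for every finite `A`. -/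

/-- ordered occupied–vacant vertex pairs of a tetrahedron pattern (`= k(4−k)`). -/
def eT4 (u : Fin 4 → Bool) : ℤ := ∑ i : Fin 4, ∑ j : Fin 4, if (u i = true ∧ u j = false) then 1 else 0
/-- number of occupied vertices of a tetrahedron pattern. -/
def occ4 (u : Fin 4 → Bool) : ℤ := ind (u 0) + ind (u 1) + ind (u 2) + ind (u 3)
/-- indicator of the full tetrahedron / octahedron pattern. -/
def full4 (u : Fin 4 → Bool) : ℤ := ind (u 0 && u 1 && u 2 && u 3)
/-- Indicator that all six octahedron vertices are occupied. -/
def full6 (b : Fin 6 → Bool) : ℤ := ind (b 0 && b 1 && b 2 && b 3 && b 4 && b 5)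

/-- tetrahedron volume table (16 patterns): `occ ≤ 4·[full] + 4·e`. -/
theorem tet_full_table4 : ∀ u₀ u₁ u₂ u₃ : Bool,
    occ4 ![u₀, u₁, u₂, u₃] ≤ 4 * full4 ![u₀, u₁, u₂, u₃] + 4 * eT4 ![u₀, u₁, u₂, u₃] := by decide
/-- Tetrahedron volume table: `occ ≤ 4·full + 4·e` for every pattern. -/
theorem tet_full_table (u : Fin 4 → Bool) : occ4 u ≤ 4 * full4 u + 4 * eT4 u := by
  have hu : u = ![u 0, u 1, u 2, u 3] := by
    funext i; fin_cases i <;> rfl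
  rw [hu]; exact tet_full_table4 _ _ _ _
/-- octahedron volume table (64 patterns): `occ ≤ 6·[full] + 6·e`. -/
theorem oct_full_table6 : ∀ b₀ b₁ b₂ b₃ b₄ b₅ : Bool,
    occ ![b₀, b₁, b₂, b₃, b₄, b₅] ≤ 6 * full6 ![b₀, b₁, b₂, b₃, b₄, b₅] + 6 * eOVb ![b₀, b₁, b₂, b₃, b₄, b₅] := by
  decide
/-- Octahedron volume table: `occ ≤ 6·full + 6·e` for every pattern. -/
theorem oct_full_table (b : Fin 6 → Bool) : occ b ≤ 6 * full6 b + 6 * eOVb b := by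
  have hb : b = ![b 0, b 1, b 2, b 3, b 4, b 5] := by
    funext i; fin_cases i <;> rfl
  rw [hb]; exact oct_full_table6 _ _ _ _ _ _

/-- the patterns of the tetrahedra at `p`. -/
def patUp (A : Finset Site) (p : Site) : Fin 4 → Bool := fun j => decide (p + tetUpV j ∈ A)
/-- Occupation pattern of the down-tetrahedron at `p`. -/
def patDn (A : Finset Site) (p : Site) : Fin 4 → Bool := fun j => decide (p + tetDnV j ∈ A)

/-- The pattern count `eT4` of the up-tetrahedron at `p` is `eTetUp A p`. -/
theorem eT4_patUp (A : Finset Site) (p : Site) : eT4 (patUp A p) = eTetUp A p := by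
  unfold eT4 eTetUp patUp
  refine sum_congr rfl fun i _ => sum_congr rfl fun j _ => ?_
  simp only [decide_eq_true_eq, decide_eq_false_iff_not]
/-- The pattern count `eT4` of the down-tetrahedron at `p` is `eTetDn A p`. -/
theorem eT4_patDn (A : Finset Site) (p : Site) : eT4 (patDn A p) = eTetDn A p := by
  unfold eT4 eTetDn patDn
  refine sum_congr rfl fun i _ => sum_congr rfl fun j _ => ?_
  simp only [decide_eq_true_eq, decide_eq_false_iff_not]

/-- `Σ_{p ∈ P} [p + v ∈ A] = #A` whenever `P ⊇ A − v`. -/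
theorem sum_ite_mem_translate (A P : Finset Site) (v : Site) (hP : ∀ x ∈ A, x - v ∈ P) :
    (∑ p ∈ P, if p + v ∈ A then (1 : ℤ) else 0) = (A.card : ℤ) := by
  classical
  have hset : (P.filter fun p => p + v ∈ A) = A.image fun x => x - v := by
    ext p
    simp only [mem_filter, mem_image]
    constructor
    · rintro ⟨-, hv⟩
      exact ⟨p + v, hv, by abel⟩
    · rintro ⟨x, hx, rfl⟩
      exact ⟨hP x hx, by simpa using hx⟩
  rw [← sum_filter, sum_const, nsmul_eq_mul, mul_one, hset, card_image_of_injective _ sub_left_injective]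

/-- `ind (decide P)` as an `if`. -/
theorem ind_decide (P : Prop) [Decidable P] : ind (decide P) = if P then 1 else 0 := by
  by_cases h : P <;> simp [ind, h]

/-- Each occupied site is a vertex of exactly four up-tetrahedra. -/
theorem sum_occ4_patUp (A : Finset Site) : ∑ p ∈ idx A, occ4 (patUp A p) = 4 * (A.card : ℤ) := by
  classical
  simp only [occ4, patUp, ind_decide, sum_add_distrib]
  rw [sum_ite_mem_translate A (idx A) _ (fun x hx => mem_idx hx (tetUpV_mem 0)),
    sum_ite_mem_translate A (idx A) _ (fun x hx => mem_idx hx (tetUpV_mem 1)),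
    sum_ite_mem_translate A (idx A) _ (fun x hx => mem_idx hx (tetUpV_mem 2)),
    sum_ite_mem_translate A (idx A) _ (fun x hx => mem_idx hx (tetUpV_mem 3))]
  ring
/-- Each occupied site is a vertex of exactly four down-tetrahedra. -/
theorem sum_occ4_patDn (A : Finset Site) : ∑ p ∈ idx A, occ4 (patDn A p) = 4 * (A.card : ℤ) := by
  classical
  simp only [occ4, patDn, ind_decide, sum_add_distrib]
  rw [sum_ite_mem_translate A (idx A) _ (fun x hx => mem_idx hx (tetDnV_mem 0)),
    sum_ite_mem_translate A (idx A) _ (fun x hx => mem_idx hx (tetDnV_mem 1)),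
    sum_ite_mem_translate A (idx A) _ (fun x hx => mem_idx hx (tetDnV_mem 2)),
    sum_ite_mem_translate A (idx A) _ (fun x hx => mem_idx hx (tetDnV_mem 3))]
  ring
/-- Each occupied site is a vertex of exactly six octahedra. -/
theorem sum_occ_patO (A : Finset Site) : ∑ p ∈ idx A, occ (patO A p) = 6 * (A.card : ℤ) := by
  classical
  simp only [occ, patO, ind_decide, sum_add_distrib]
  rw [sum_ite_mem_translate A (idx A) _ (fun x hx => mem_idx hx (octV_mem 0)),
    sum_ite_mem_translate A (idx A) _ (fun x hx => mem_idx hx (octV_mem 1)),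
    sum_ite_mem_translate A (idx A) _ (fun x hx => mem_idx hx (octV_mem 2)),
    sum_ite_mem_translate A (idx A) _ (fun x hx => mem_idx hx (octV_mem 3)),
    sum_ite_mem_translate A (idx A) _ (fun x hx => mem_idx hx (octV_mem 4)),
    sum_ite_mem_translate A (idx A) _ (fun x hx => mem_idx hx (octV_mem 5))]
  ring

/-- the volume of the full cells in units of `|T| = 1/(6√2)`. -/
def fullVolT (A : Finset Site) : ℤ :=
  ∑ p ∈ idx A, (full4 (patUp A p) + full4 (patDn A p) + 4 * full6 (patO A p))

/-- **Volume of the full cells**: `6·#A − 10·B∂(A) ≤ fullVolT A` (every finite `A`), i.e.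
`|Full(A)| ≥ #A/√2 − (10/(3√2))·D(A)`. -/
theorem fullVolT_ge (A : Finset Site) :
    6 * (A.card : ℤ) - 10 * (bdPairs A : ℤ) ≤ fullVolT A := by
  classical
  have hpt : ∀ p ∈ idx A,
      3 * occ4 (patUp A p) - 12 * eTetUp A p + (3 * occ4 (patDn A p) - 12 * eTetDn A p)
        + (8 * occ (patO A p) - 48 * eOct A p)
      ≤ 12 * (full4 (patUp A p) + full4 (patDn A p) + 4 * full6 (patO A p)) := by
    intro p _
    have hU := tet_full_table (patUp A p)
    have hD := tet_full_table (patDn A p)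
    have hO := oct_full_table (patO A p)
    rw [eT4_patUp] at hU
    rw [eT4_patDn] at hD
    rw [eOVb_patO] at hO
    linarith
  have hsum := sum_le_sum hpt
  rw [← mul_sum] at hsum
  have hl : ∑ p ∈ idx A, (3 * occ4 (patUp A p) - 12 * eTetUp A p
      + (3 * occ4 (patDn A p) - 12 * eTetDn A p) + (8 * occ (patO A p) - 48 * eOct A p))
      = 72 * (A.card : ℤ) - 120 * (bdPairs A : ℤ) := by
    simp only [sum_add_distrib, sum_sub_distrib, ← mul_sum, sum_occ4_patUp, sum_occ4_patDn,
      sum_occ_patO, sum_eTetUp, sum_eTetDn, sum_eOct]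
    ring
  rw [hl] at hsum
  unfold fullVolT
  linarith



end Summit.Ventures.Crystal3D.TentCertificate
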